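import Literature.NumberTheory.Sieve.SmoothArcClassesPointwise
import Literature.NumberTheory.Sieve.SmoothArcClassUniformity
import HarnessLib

/-!
# Class-restricted friable arc sums: the exact principal part for an arbitrary level

Topic `Literature/NumberTheory/Sieve`; a PROVED file sharpening `SmoothArcClasses` / `SmoothArcClassesPointwise`
([MontgomeryVaughanActa1975, §6 (6.1)], [Harper2016, §2.2, §5]). Notation of those files: `S(X, y)` the `y`-friable
integers `≤ X` (`Nat.smoothNumbersUpTo ⌊X⌋₊ (y+1)`), `W_λ` = `twistWeight`, `U(X, L') = coprimeTwistSum X y L' λ`,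
`L = lcm(k, m)`, `g_t = (t, L)`, and `classWeightedSum W m r k h = Σ_{t < L, t ≡ r (m)} e(ht/k) W(g_t)`.

The fibre lemmas of `SmoothArcClasses` (`filter_mod_eq_image`, `sum_filter_mod_eq`) and the pointwise bound
`fiber_sub_principal_bound` assume that the LEVEL `L` is `y`-friable. Only the gcd `g_t` has to be:

* `filter_mod_eq_image_of_gcd_mem`, `sum_filter_mod_eq_of_gcd_mem` (A1): for `t < L`, `g = (t, L) ∈ S(y)`,
  `{n ∈ S(X,y) : n % L = t} = g · {n' ∈ S(X/g, y) : n' ≡ t/g (mod L/g)}` (if `g` is friable, `g n'` is friable iff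
  `n'` is), so `V(t) := Σ_{n ∈ S(X,y), n % L = t} W_λ(n/X) = Σ_{n' ∈ S(X/g,y), n' ≡ t/g (L/g)} W_λ(n'/(X/g))`;
* `filter_mod_eq_empty_of_not_mem`, `sum_filter_mod_eq_zero_of_not_mem` (A2): if `g_t ∉ S(y)` the fibre is EMPTY
  (`g_t ∣ n` for `n ≡ t (L)`, and divisors of friable numbers are friable), so `V(t) = 0`;
* `principalWeight X y L λ g = [g ∈ S(y)] · φ(L/g)⁻¹ U(X/g, L/g)`: the exact principal weight of the fibres with gcd `g`;
* `fiber_sub_principal_bound'` (A3): for ANY `L ≥ 1`, `t < L`: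
  `‖V(t) − principalWeight X y L λ g_t‖ ≤ Bd` as soon as every non-principal character sum
  `Σ_{n ∈ S(X/g', y)} ψ(n) W_λ(n/(X/g'))` (`g' ≥ 1`, `ψ ≠ ψ₀ mod L'' ≤ L`) is at most `Bd` (cases A1/A2, orthogonality
  `classFiber_eq` and `nonprincipal_fiber_bound`);
* **`classArcSum_sub_classWeightedSum_le`** (A4): for `X ≥ 0`, `k, m ≥ 1`, ANY `r`, `h ∈ ℤ`, `λ`, under the same input,
  `‖classArcSum X y m r k h λ − classWeightedSum (principalWeight X y L λ) m r k h‖ ≤ L · Bd`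
  (`classArcSum_eq_sum_mod` and A3 class by class; `classArcSum_sub_classWeightedSum_le'` is the same with the weight
  written out);
* linearity of `classWeightedSum` in the weights (`classWeightedSum_add/sub/neg/const_mul/zero/finset_sum`) and the
  corollaries for differences (boxes in `n`, `classArcSum_sub_sub_classWeightedSum_le`, error `2 L Bd`) and finite linear
  combinations (`sum_mul_classArcSum_sub_classWeightedSum_le`, error `(Σ‖c_i‖) L Bd`).

Purpose: on a major arc `a/k + β` with `k` up to a power of `x` the level `lcm(k, m)` is not friable, but the principal
parts in `classWeightedSum` form still cancel across unit classes by the class-uniformity identities of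
`SmoothArcClassUniformity*`, WHATEVER the weights; this file supplies the exact decomposition they act on. Nothing here
estimates `principalWeight` itself (that is `principal_fiber_bound` of `SmoothArcClassesEstimate` when `L ∈ S(y)`).

## References

* H. L. Montgomery, R. C. Vaughan, Acta Arith. 27 (1975), §6 [MontgomeryVaughanActa1975].
* A. J. Harper, Compositio Math. 152 (2016), §2.2, §5 [Harper2016].
-/

noncomputable section

open Finset Real Complex
open scoped ArithmeticFunction.Moebius FourierTransform

namespace Literature.NumberTheory.Sieve

namespace SmoothArcs

open MontgomeryVaughan1975 TwistedWeight

/-! ### A1/A2: the fibre `n ≡ t (mod L)` for an arbitrary level `L` -/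

/-- `(t, L) ∣ n` whenever `n % L = t` (`n = t + L ⌊n/L⌋`). [folklore] -/
theorem gcd_dvd_of_mod_eq {L n t : ℕ} (hn : n % L = t) : Nat.gcd t L ∣ n := by
  have h1 : t + L * (n / L) = n := by rw [← hn]; exact Nat.mod_add_div n L
  rw [← h1]
  exact dvd_add (Nat.gcd_dvd_left t L) (dvd_mul_of_dvd_left (Nat.gcd_dvd_right t L) _)

/-- **A1 (sets).** For `t < L`, `g = (t, L) ∈ S(y)`, `L' = L/g`, `t' = t/g` (NO friability assumption on `L`): the
`y`-friable `n ≤ X` with `n % L = t` are exactly the `g n'` with `n' ∈ S(X/g, y)`, `n' ≡ t' (mod L')`. [folklore] -/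
theorem filter_mod_eq_image_of_gcd_mem {X : ℝ} (hX : 0 ≤ X) {y L t : ℕ} (hL : L ≠ 0) (ht : t < L)
    (hgS : Nat.gcd t L ∈ Nat.smoothNumbers (y + 1)) :
    (Nat.smoothNumbersUpTo ⌊X⌋₊ (y + 1)).filter (fun n => n % L = t) =
      ((Nat.smoothNumbersUpTo ⌊X / Nat.gcd t L⌋₊ (y + 1)).filter
        (fun n' => n' ≡ t / Nat.gcd t L [MOD L / Nat.gcd t L])).image (fun n' => Nat.gcd t L * n') := by
  set g := Nat.gcd t L
  have hg0 : 0 < g := Nat.gcd_pos_of_pos_right t (Nat.pos_of_ne_zero hL)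
  obtain ⟨t', ht'⟩ : g ∣ t := Nat.gcd_dvd_left t L
  obtain ⟨L', hL'⟩ : g ∣ L := Nat.gcd_dvd_right t L
  have htg : t / g = t' := by rw [ht', Nat.mul_div_cancel_left t' hg0]
  have hLg : L / g = L' := by rw [hL', Nat.mul_div_cancel_left L' hg0]
  rw [htg, hLg]
  have hg0' : (0 : ℝ) < g := by exact_mod_cast hg0
  ext n
  simp only [Finset.mem_filter, Finset.mem_image, Nat.mem_smoothNumbersUpTo]
  constructor
  · rintro ⟨⟨hnx, hnS⟩, hnt⟩
    set q : ℕ := n / L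
    have h1 : t + L * q = n := by rw [← hnt]; exact Nat.mod_add_div n L
    have hn : n = g * (t' + L' * q) := by
      calc n = t + L * q := h1.symm
        _ = g * t' + g * L' * q := by rw [← ht', ← hL']
        _ = g * (t' + L' * q) := by ring
    refine ⟨t' + L' * q, ⟨⟨?_, ?_⟩, ?_⟩, hn.symm⟩
    · rw [Nat.le_floor_iff (by positivity), le_div_iff₀ hg0']
      have h2 := (Nat.le_floor_iff hX).mp hnx
      rw [hn] at h2
      push_cast at h2 ⊢
      linarith
    · exact Nat.mem_smoothNumbers_of_dvd hnS ⟨g, by rw [mul_comm]; exact hn⟩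
    · unfold Nat.ModEq
      rw [Nat.add_mul_mod_self_left]
  · rintro ⟨n', ⟨⟨hn'x, hn'S⟩, hmod⟩, rfl⟩
    refine ⟨⟨?_, Nat.mul_mem_smoothNumbers hgS hn'S⟩, ?_⟩
    · rw [Nat.le_floor_iff hX]
      have h2 := (Nat.le_floor_iff (by positivity)).mp hn'x
      rw [le_div_iff₀ hg0'] at h2
      push_cast
      linarith
    · have h1 : g * n' ≡ t [MOD L] := by rw [ht', hL']; exact Nat.ModEq.mul_left' g hmod
      unfold Nat.ModEq at h1
      rw [h1, Nat.mod_eq_of_lt ht]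

/-- **A1 (sums).** `Σ_{n ∈ S(X,y), n % L = t} W_λ(n/X) = Σ_{n' ∈ S(X/g,y), n' ≡ t' (L')} W_λ(n'/(X/g))`
(`g = (t, L) ∈ S(y)`, `L' = L/g`, `t' = t/g`, `t < L`; the level `L ≥ 1` is arbitrary). [folklore] -/
theorem sum_filter_mod_eq_of_gcd_mem {X : ℝ} (hX : 0 ≤ X) {y L t : ℕ} (hL : L ≠ 0) (ht : t < L)
    (hgS : Nat.gcd t L ∈ Nat.smoothNumbers (y + 1)) (lam : ℝ) :
    ∑ n ∈ (Nat.smoothNumbersUpTo ⌊X⌋₊ (y + 1)).filter (fun n => n % L = t), twistWeight lam (n / X) =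
      ∑ n' ∈ (Nat.smoothNumbersUpTo ⌊X / Nat.gcd t L⌋₊ (y + 1)).filter
        (fun n' => n' ≡ t / Nat.gcd t L [MOD L / Nat.gcd t L]), twistWeight lam (n' / (X / Nat.gcd t L)) := by
  have hg0 : 0 < Nat.gcd t L := Nat.gcd_pos_of_pos_right t (Nat.pos_of_ne_zero hL)
  rw [filter_mod_eq_image_of_gcd_mem hX hL ht hgS,
    Finset.sum_image (fun a _ b _ hab => (Nat.mul_right_inj hg0.ne').mp hab)]
  refine Finset.sum_congr rfl fun n' _ => ?_
  have hdiv : ((Nat.gcd t L * n' : ℕ) : ℝ) / X = (n' : ℝ) / (X / Nat.gcd t L) := by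
    have : ((Nat.gcd t L : ℕ) : ℝ) ≠ 0 := by exact_mod_cast hg0.ne'
    push_cast
    field_simp
  rw [hdiv]

/-- **A2 (sets).** If `(t, L) ∉ S(y)` the fibre `{n ∈ S(X,y) : n % L = t}` is empty: `(t, L)` divides every such `n`
and divisors of `y`-friable numbers are `y`-friable. [folklore] -/
theorem filter_mod_eq_empty_of_not_mem {N y L t : ℕ} (hgS : Nat.gcd t L ∉ Nat.smoothNumbers (y + 1)) :
    (Nat.smoothNumbersUpTo N (y + 1)).filter (fun n => n % L = t) = ∅ :=
  Finset.filter_eq_empty_iff.mpr fun _ hn hnt =>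
    hgS (Nat.mem_smoothNumbers_of_dvd (Nat.mem_smoothNumbersUpTo.mp hn).2 (gcd_dvd_of_mod_eq hnt))

/-- **A2 (sums).** If `(t, L) ∉ S(y)` then `Σ_{n ∈ S(X,y), n % L = t} W_λ(n/X) = 0` (empty sum). [folklore] -/
theorem sum_filter_mod_eq_zero_of_not_mem (X : ℝ) {y L t : ℕ} (hgS : Nat.gcd t L ∉ Nat.smoothNumbers (y + 1))
    (lam : ℝ) :
    ∑ n ∈ (Nat.smoothNumbersUpTo ⌊X⌋₊ (y + 1)).filter (fun n => n % L = t), twistWeight lam (n / X) = 0 := by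
  rw [filter_mod_eq_empty_of_not_mem hgS, Finset.sum_empty]

/-! ### The exact principal weight -/

/-- **The exact principal weight** of the fibres of `classArcSum X y m r k h λ` with gcd `g` (`L = lcm(k, m)`):
`principalWeight X y L λ g = φ(L/g)⁻¹ · U(X/g, L/g) = φ(L/g)⁻¹ Σ_{n' ∈ S(X/g, y), (n', L/g) = 1} W_λ(n'/(X/g))` if
`g ∈ S(y)`, and `0` if `g` is not `y`-friable (the fibres are then empty). Only the values at `g ∣ L` matter.
[cite: MontgomeryVaughanActa1975, §6 (6.1)] -/
def principalWeight (X : ℝ) (y L : ℕ) (lam : ℝ) (g : ℕ) : ℂ :=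
  if g ∈ Nat.smoothNumbers (y + 1) then ((((L / g).totient : ℕ) : ℂ))⁻¹ * coprimeTwistSum (X / g) y (L / g) lam
  else 0

/-- Unfolding `principalWeight`. [folklore] -/
theorem principalWeight_apply (X : ℝ) (y L : ℕ) (lam : ℝ) (g : ℕ) :
    principalWeight X y L lam g =
      if g ∈ Nat.smoothNumbers (y + 1) then ((((L / g).totient : ℕ) : ℂ))⁻¹ * coprimeTwistSum (X / g) y (L / g) lam
      else 0 :=
  rfl

/-- `principalWeight X y L λ g = φ(L/g)⁻¹ U(X/g, L/g)` for friable `g`. [folklore] -/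
@[simp] theorem principalWeight_of_mem {X : ℝ} {y L : ℕ} {lam : ℝ} {g : ℕ} (hg : g ∈ Nat.smoothNumbers (y + 1)) :
    principalWeight X y L lam g = ((((L / g).totient : ℕ) : ℂ))⁻¹ * coprimeTwistSum (X / g) y (L / g) lam :=
  if_pos hg

/-- `principalWeight X y L λ g = 0` for non-friable `g`. [folklore] -/
@[simp] theorem principalWeight_of_not_mem {X : ℝ} {y L : ℕ} {lam : ℝ} {g : ℕ} (hg : g ∉ Nat.smoothNumbers (y + 1)) :
    principalWeight X y L lam g = 0 :=
  if_neg hg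

/-! ### A3: one fibre minus its exact principal part -/

/-- **A3. One fibre minus its principal part, arbitrary level.** For `L ≥ 1`, `t < L`, `g = (t, L)`: if every
non-principal character sum on every sub-scale `X/g'` (`g' ≥ 1`) to every modulus `L'' ≤ L` is at most `Bd ≥ 0`, then
`‖Σ_{n ∈ S(X,y), n % L = t} W_λ(n/X) − principalWeight X y L λ g‖ ≤ Bd`: for friable `g` the difference is the
contribution of the non-principal characters mod `L/g` (`classFiber_eq`), otherwise both terms vanish.
[cite: MontgomeryVaughanActa1975, §6 (6.1)] -/
theorem fiber_sub_principal_bound' {X : ℝ} (hX : 0 ≤ X) {y L t : ℕ} (hL : L ≠ 0) (ht : t < L) (lam : ℝ) {Bd : ℝ}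
    (hBd : 0 ≤ Bd)
    (hF : ∀ (g' L'' : ℕ) [NeZero L''], 0 < g' → L'' ≤ L → ∀ ψ : DirichletCharacter ℂ L'', ψ ≠ 1 →
      ‖∑ n ∈ Nat.smoothNumbersUpTo ⌊X / g'⌋₊ (y + 1), ψ (n : ZMod L'') * twistWeight lam (n / (X / g'))‖ ≤ Bd) :
    ‖(∑ n ∈ (Nat.smoothNumbersUpTo ⌊X⌋₊ (y + 1)).filter (fun n => n % L = t), twistWeight lam (n / X)) -
        principalWeight X y L lam (Nat.gcd t L)‖ ≤ Bd := by
  by_cases hgS : Nat.gcd t L ∈ Nat.smoothNumbers (y + 1)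
  · rw [principalWeight_of_mem hgS, sum_filter_mod_eq_of_gcd_mem hX hL ht hgS lam]
    set g : ℕ := Nat.gcd t L
    have hg0 : 0 < g := Nat.gcd_pos_of_pos_right t (Nat.pos_of_ne_zero hL)
    have hgL : g ∣ L := Nat.gcd_dvd_right t L
    have hL'0 : L / g ≠ 0 := (Nat.div_ne_zero_iff_of_dvd hgL).mpr ⟨hL, hg0.ne'⟩
    haveI : NeZero (L / g) := ⟨hL'0⟩
    have hcop : (t / g).Coprime (L / g) := Nat.coprime_div_gcd_div_gcd hg0
    rw [classFiber_eq (X / g) y hcop lam, add_sub_cancel_left]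
    exact nonprincipal_fiber_bound (X / g) y (((t / g : ℕ) : ZMod (L / g)))⁻¹ lam hBd
      (fun ψ hψ => hF g (L / g) hg0 (Nat.div_le_self L g) ψ hψ)
  · rw [principalWeight_of_not_mem hgS, sum_filter_mod_eq_zero_of_not_mem X hgS lam, sub_zero, norm_zero]
    exact hBd

/-- A3 with the principal part written out as
`[g_t ∈ S(y)] · φ(L/g_t)⁻¹ U(X/g_t, L/g_t)`. [cite: MontgomeryVaughanActa1975, §6 (6.1)] -/
theorem fiber_sub_ite_principal_bound {X : ℝ} (hX : 0 ≤ X) {y L t : ℕ} (hL : L ≠ 0) (ht : t < L) (lam : ℝ) {Bd : ℝ}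
    (hBd : 0 ≤ Bd)
    (hF : ∀ (g' L'' : ℕ) [NeZero L''], 0 < g' → L'' ≤ L → ∀ ψ : DirichletCharacter ℂ L'', ψ ≠ 1 →
      ‖∑ n ∈ Nat.smoothNumbersUpTo ⌊X / g'⌋₊ (y + 1), ψ (n : ZMod L'') * twistWeight lam (n / (X / g'))‖ ≤ Bd) :
    ‖(∑ n ∈ (Nat.smoothNumbersUpTo ⌊X⌋₊ (y + 1)).filter (fun n => n % L = t), twistWeight lam (n / X)) -
        (if Nat.gcd t L ∈ Nat.smoothNumbers (y + 1) then
          ((((L / Nat.gcd t L).totient : ℕ) : ℂ))⁻¹ * coprimeTwistSum (X / Nat.gcd t L) y (L / Nat.gcd t L) lam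
        else 0)‖ ≤ Bd :=
  fiber_sub_principal_bound' hX hL ht lam hBd hF

/-! ### A4: the class sum minus its exact principal part -/

/-- **A4. Exact principal/non-principal decomposition of class-restricted friable arc sums, arbitrary level.**
For `X ≥ 0`, `k, m ≥ 1`, ANY class `r`, numerator `h ∈ ℤ` and twist `λ`, `L = lcm(k, m)`, `Bd ≥ 0`: if every
non-principal character sum `Σ_{n ∈ S(X/g', y)} ψ(n) W_λ(n/(X/g'))` (`g' ≥ 1`, `ψ ≠ ψ₀ (mod L'')`, `L'' ≤ L`) has norm
`≤ Bd`, then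
`‖classArcSum X y m r k h λ − classWeightedSum (principalWeight X y L λ) m r k h‖ ≤ L · Bd`,
i.e. `classArcSum = Σ_{t < L, t ≡ r (m)} e(ht/k) [g_t ∈ S(y)] φ(L/g_t)⁻¹ U(X/g_t, L/g_t) + O(L · Bd)` with NO
friability assumption on `k` or `m` (`classArcSum_eq_sum_mod`, then A3 class by class, `≤ L` classes).
[cite: MontgomeryVaughanActa1975, §6 (6.1)] -/
theorem classArcSum_sub_classWeightedSum_le {X : ℝ} (hX : 0 ≤ X) (y : ℕ) {m k : ℕ} (hm : m ≠ 0) (hk : k ≠ 0)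
    (r : ℕ) (h : ℤ) (lam : ℝ) {Bd : ℝ} (hBd : 0 ≤ Bd)
    (hF : ∀ (g' L'' : ℕ) [NeZero L''], 0 < g' → L'' ≤ Nat.lcm k m → ∀ ψ : DirichletCharacter ℂ L'', ψ ≠ 1 →
      ‖∑ n ∈ Nat.smoothNumbersUpTo ⌊X / g'⌋₊ (y + 1), ψ (n : ZMod L'') * twistWeight lam (n / (X / g'))‖ ≤ Bd) :
    ‖classArcSum X y m r k h lam - classWeightedSum (principalWeight X y (Nat.lcm k m) lam) m r k h‖ ≤
      (Nat.lcm k m : ℝ) * Bd := by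
  have hL0 : Nat.lcm k m ≠ 0 := Nat.lcm_ne_zero hk hm
  rw [classArcSum_eq_sum_mod X y hm hk r h lam, classWeightedSum, ← Finset.sum_sub_distrib]
  refine (norm_sum_le _ _).trans ?_
  have hterm : ∀ t ∈ (Finset.range (Nat.lcm k m)).filter (fun t => t ≡ r [MOD m]),
      ‖(𝐞 ((h * t : ℝ) / k) : ℂ) *
            (∑ n ∈ (Nat.smoothNumbersUpTo ⌊X⌋₊ (y + 1)).filter (fun n => n % Nat.lcm k m = t),
              twistWeight lam (n / X)) -
          (𝐞 ((h * t : ℝ) / k) : ℂ) * principalWeight X y (Nat.lcm k m) lam (Nat.gcd t (Nat.lcm k m))‖ ≤ Bd := by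
    intro t ht
    have htL : t < Nat.lcm k m := Finset.mem_range.mp (Finset.mem_filter.mp ht).1
    rw [← mul_sub, norm_mul, Circle.norm_coe, one_mul]
    exact fiber_sub_principal_bound' hX hL0 htL lam hBd hF
  refine (Finset.sum_le_sum hterm).trans ?_
  rw [Finset.sum_const, nsmul_eq_mul]
  have hcard : (((Finset.range (Nat.lcm k m)).filter (fun t => t ≡ r [MOD m])).card : ℝ) ≤ Nat.lcm k m := by
    exact_mod_cast (Finset.card_filter_le _ _).trans (Finset.card_range _).le
  exact mul_le_mul_of_nonneg_right hcard hBd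

/-- **A4 with the weight written out**: under the hypotheses of `classArcSum_sub_classWeightedSum_le`,
`‖classArcSum X y m r k h λ − classWeightedSum (g ↦ [g ∈ S(y)] φ(L/g)⁻¹ U(X/g, L/g)) m r k h‖ ≤ L · Bd`.
[cite: MontgomeryVaughanActa1975, §6 (6.1)] -/
theorem classArcSum_sub_classWeightedSum_le' {X : ℝ} (hX : 0 ≤ X) (y : ℕ) {m k : ℕ} (hm : m ≠ 0) (hk : k ≠ 0)
    (r : ℕ) (h : ℤ) (lam : ℝ) {Bd : ℝ} (hBd : 0 ≤ Bd)
    (hF : ∀ (g' L'' : ℕ) [NeZero L''], 0 < g' → L'' ≤ Nat.lcm k m → ∀ ψ : DirichletCharacter ℂ L'', ψ ≠ 1 →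
      ‖∑ n ∈ Nat.smoothNumbersUpTo ⌊X / g'⌋₊ (y + 1), ψ (n : ZMod L'') * twistWeight lam (n / (X / g'))‖ ≤ Bd) :
    ‖classArcSum X y m r k h lam -
        classWeightedSum (fun g => if g ∈ Nat.smoothNumbers (y + 1) then
          ((((Nat.lcm k m / g).totient : ℕ) : ℂ))⁻¹ * coprimeTwistSum (X / g) y (Nat.lcm k m / g) lam else 0)
          m r k h‖ ≤
      (Nat.lcm k m : ℝ) * Bd :=
  classArcSum_sub_classWeightedSum_le hX y hm hk r h lam hBd hF

/-! ### A5: linearity in the weights; boxes and linear combinations -/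

/-- `classWeightedSum` is additive in the weights. [folklore] -/
theorem classWeightedSum_add (W W' : ℕ → ℂ) (m r k : ℕ) (h : ℤ) :
    classWeightedSum (fun g => W g + W' g) m r k h = classWeightedSum W m r k h + classWeightedSum W' m r k h := by
  unfold classWeightedSum
  rw [← Finset.sum_add_distrib]
  exact Finset.sum_congr rfl fun t _ => mul_add _ _ _

/-- `classWeightedSum` of a difference of weights. [folklore] -/
theorem classWeightedSum_sub (W W' : ℕ → ℂ) (m r k : ℕ) (h : ℤ) :
    classWeightedSum (fun g => W g - W' g) m r k h = classWeightedSum W m r k h - classWeightedSum W' m r k h := by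
  unfold classWeightedSum
  rw [← Finset.sum_sub_distrib]
  exact Finset.sum_congr rfl fun t _ => mul_sub _ _ _

/-- `classWeightedSum` of the negated weights. [folklore] -/
theorem classWeightedSum_neg (W : ℕ → ℂ) (m r k : ℕ) (h : ℤ) :
    classWeightedSum (fun g => -W g) m r k h = -classWeightedSum W m r k h := by
  unfold classWeightedSum
  rw [← Finset.sum_neg_distrib]
  exact Finset.sum_congr rfl fun t _ => mul_neg _ _

/-- `classWeightedSum` is homogeneous in the weights. [folklore] -/
theorem classWeightedSum_const_mul (c : ℂ) (W : ℕ → ℂ) (m r k : ℕ) (h : ℤ) :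
    classWeightedSum (fun g => c * W g) m r k h = c * classWeightedSum W m r k h := by
  unfold classWeightedSum
  rw [Finset.mul_sum]
  exact Finset.sum_congr rfl fun t _ => by ring

/-- `classWeightedSum` of the zero weights vanishes. [folklore] -/
theorem classWeightedSum_zero (m r k : ℕ) (h : ℤ) : classWeightedSum (fun _ => 0) m r k h = 0 := by
  unfold classWeightedSum
  exact Finset.sum_eq_zero fun t _ => mul_zero _

/-- `classWeightedSum` of a finite linear combination of weights. [folklore] -/
theorem classWeightedSum_finset_sum {ι : Type*} (s : Finset ι) (c : ι → ℂ) (W : ι → ℕ → ℂ) (m r k : ℕ) (h : ℤ) :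
    classWeightedSum (fun g => ∑ i ∈ s, c i * W i g) m r k h = ∑ i ∈ s, c i * classWeightedSum (W i) m r k h := by
  classical
  induction s using Finset.induction_on with
  | empty => simpa using classWeightedSum_zero m r k h
  | insert i s hi ih =>
    rw [Finset.sum_insert hi, ← ih, ← classWeightedSum_const_mul, ← classWeightedSum_add]
    exact Finset.sum_congr rfl fun t _ => by simp only [Finset.sum_insert hi]

/-- **A5 (boxes).** Two class sums with the same `y, m, r, k, h` at scales/twists `(X, λ)` and `(X', λ')` (e.g. the
two ends of a box in `n`): under the character-sum input for both,
`‖(classArcSum X … λ − classArcSum X' … λ') − classWeightedSum (principalWeight X y L λ − principalWeight X' y L λ') m r k h‖`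
`≤ 2 L Bd`. [cite: MontgomeryVaughanActa1975, §6 (6.1)] -/
theorem classArcSum_sub_sub_classWeightedSum_le {X X' : ℝ} (hX : 0 ≤ X) (hX' : 0 ≤ X') (y : ℕ) {m k : ℕ}
    (hm : m ≠ 0) (hk : k ≠ 0) (r : ℕ) (h : ℤ) (lam lam' : ℝ) {Bd : ℝ} (hBd : 0 ≤ Bd)
    (hF : ∀ (g' L'' : ℕ) [NeZero L''], 0 < g' → L'' ≤ Nat.lcm k m → ∀ ψ : DirichletCharacter ℂ L'', ψ ≠ 1 →
      ‖∑ n ∈ Nat.smoothNumbersUpTo ⌊X / g'⌋₊ (y + 1), ψ (n : ZMod L'') * twistWeight lam (n / (X / g'))‖ ≤ Bd)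
    (hF' : ∀ (g' L'' : ℕ) [NeZero L''], 0 < g' → L'' ≤ Nat.lcm k m → ∀ ψ : DirichletCharacter ℂ L'', ψ ≠ 1 →
      ‖∑ n ∈ Nat.smoothNumbersUpTo ⌊X' / g'⌋₊ (y + 1), ψ (n : ZMod L'') * twistWeight lam' (n / (X' / g'))‖ ≤ Bd) :
    ‖(classArcSum X y m r k h lam - classArcSum X' y m r k h lam') -
        classWeightedSum (fun g => principalWeight X y (Nat.lcm k m) lam g - principalWeight X' y (Nat.lcm k m) lam' g)
          m r k h‖ ≤
      2 * (Nat.lcm k m : ℝ) * Bd := by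
  rw [classWeightedSum_sub, sub_sub_sub_comm, two_mul, add_mul]
  exact (norm_sub_le _ _).trans (add_le_add (classArcSum_sub_classWeightedSum_le hX y hm hk r h lam hBd hF)
    (classArcSum_sub_classWeightedSum_le hX' y hm hk r h lam' hBd hF'))

/-- **A5 (linear combinations).** For finitely many scales/twists `(X_i, λ_i)` and coefficients `c_i ∈ ℂ` with the
character-sum input at every `(X_i, λ_i)`:
`‖Σ_i c_i classArcSum X_i … λ_i − classWeightedSum (g ↦ Σ_i c_i principalWeight X_i y L λ_i g) m r k h‖ ≤ (Σ_i ‖c_i‖) L Bd`.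
[cite: MontgomeryVaughanActa1975, §6 (6.1)] -/
theorem sum_mul_classArcSum_sub_classWeightedSum_le {ι : Type*} (s : Finset ι) (c : ι → ℂ) {Xs : ι → ℝ}
    (hX : ∀ i ∈ s, 0 ≤ Xs i) (y : ℕ) {m k : ℕ} (hm : m ≠ 0) (hk : k ≠ 0) (r : ℕ) (h : ℤ) (lams : ι → ℝ) {Bd : ℝ}
    (hBd : 0 ≤ Bd)
    (hF : ∀ i ∈ s, ∀ (g' L'' : ℕ) [NeZero L''], 0 < g' → L'' ≤ Nat.lcm k m → ∀ ψ : DirichletCharacter ℂ L'', ψ ≠ 1 →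
      ‖∑ n ∈ Nat.smoothNumbersUpTo ⌊Xs i / g'⌋₊ (y + 1), ψ (n : ZMod L'') * twistWeight (lams i) (n / (Xs i / g'))‖ ≤
        Bd) :
    ‖∑ i ∈ s, c i * classArcSum (Xs i) y m r k h (lams i) -
        classWeightedSum (fun g => ∑ i ∈ s, c i * principalWeight (Xs i) y (Nat.lcm k m) (lams i) g) m r k h‖ ≤
      (∑ i ∈ s, ‖c i‖) * (Nat.lcm k m : ℝ) * Bd := by
  rw [classWeightedSum_finset_sum, ← Finset.sum_sub_distrib, Finset.sum_mul, Finset.sum_mul]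
  refine (norm_sum_le _ _).trans (Finset.sum_le_sum fun i hi => ?_)
  rw [← mul_sub, norm_mul, mul_assoc]
  exact mul_le_mul_of_nonneg_left (classArcSum_sub_classWeightedSum_le (hX i hi) y hm hk r h (lams i) hBd (hF i hi))
    (norm_nonneg _)

end SmoothArcs

end Literature.NumberTheory.Sieve

end
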